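import Summits.ABC.ABC.Theses.CongruentialReceptacle
import Summits.ABC.ABC.Theorems.CongruentialReceptacleQuarterWindowGivesCrux
import Summits.ABC.ABC.Theorems.CongruentialReceptacleAssembly
import Literature.NumberTheory.DiophantineGeometry.PastenSubexpTheorem14
import HarnessLib

/-!
# Thin-window rigidity: transport of the logarithmic abc bound along the swap `a ↔ b`

Stub `stub_thinWindowSwap` of the line `Descent` (card `balance-window-descent`) for the crux
stmt-ABC-1723 `BalancedFreySzpiro` (Szpiro `6+ε` for the Frey curves of balanced abc triples).

The line transports the logarithmic abc bound `log c ≤ K' + (1+e) · log rad(abc)` along maps of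
abc triples acting on the balance coordinate `t = a/c`. This file is the (free) transport along
the swap `S : (a, b, c) ↦ (b, a, c)`: the swapped triple is again an abc triple
(`IsABCTriple.swap`), its balance coordinate is `b/c = 1 - a/c` (from `a + b = c`), and its
radical is unchanged (`rad_swap : rad b a c = rad a b c`). Hence a bound valid for the triples
with `a/c ∈ T` holds, with the same constants `K'`, `e`, for the triples with `1 - a/c ∈ T`.
-/

-- `Summit.<Summit>.<Problem>` is the mandated summit-side namespace (CONVENTIONS §2); for the
-- single-conjunct summit `ABC` the two coincide, so the duplicate `ABC.ABC` is deliberate.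
set_option linter.dupNamespace false

noncomputable section

open Real
open Literature.NumberTheory.DiophantineGeometry
open Summit.ABC.ABC.Theses.CongruentialReceptacle

namespace Summit.ABC.ABC.Theorems

/-- **Transport along the swap `a ↔ b`.** If the logarithmic abc bound
`log c ≤ K' + (1+e) · log rad(abc)` holds for every abc triple with balance coordinate `a/c ∈ T`,
then it holds (same `K'`, `e`) for every abc triple with `1 - a/c ∈ T`: apply the hypothesis to
the swapped triple `(b, a, c)`, whose coordinate is `b/c = 1 - a/c` and whose radical is
`rad(bac) = rad(abc)`. [folklore] -/
theorem stub_thinWindowSwap {T : Set ℝ} {e K' : ℝ}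
    (H : ∀ a b c : ℕ, IsABCTriple a b c → (a : ℝ) / (c : ℝ) ∈ T →
      Real.log (c : ℝ) ≤ K' + (1 + e) * Real.log ((rad a b c : ℕ) : ℝ)) :
    ∀ a b c : ℕ, IsABCTriple a b c →
      (a : ℝ) / (c : ℝ) ∈ {t : ℝ | 1 - t ∈ T} →
        Real.log (c : ℝ) ≤ K' + (1 + e) * Real.log ((rad a b c : ℕ) : ℝ) := by
  intro a b c h ht
  simp only [Set.mem_setOf_eq] at ht
  -- `c = a + b > 0`, so `(c : ℝ) ≠ 0`.
  have hc : (c : ℝ) ≠ 0 := by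
    obtain ⟨ha, -, habc, -⟩ := h
    have hc0 : 0 < c := by omega
    exact_mod_cast hc0.ne'
  -- The balance coordinate of the swapped triple: `b/c = 1 - a/c`.
  have hcoord : (b : ℝ) / (c : ℝ) = 1 - (a : ℝ) / (c : ℝ) := by
    obtain ⟨-, -, habc, -⟩ := h
    rw [eq_sub_iff_add_eq, ← add_div, div_eq_one_iff_eq hc]
    exact_mod_cast (by omega : b + a = c)
  -- Apply the hypothesis to the swapped triple `(b, a, c)` and undo the swap in the radical.
  have hmem : (b : ℝ) / (c : ℝ) ∈ T := by
    rw [hcoord]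
    exact ht
  have key := H b a c h.swap hmem
  rwa [rad_swap] at key

end Summit.ABC.ABC.Theorems

end
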